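import Mathlib
import Summits.Ventures.PercRepro2.HCov
import Summits.Ventures.PercRepro2.RootLeafUHalf
import Summits.Ventures.PercRepro2.RootLeafUMixK
import Summits.Ventures.PercRepro2.RootLeafUMixKA
import Summits.Ventures.PercRepro2.RootLeafUMixMax
import Summits.Ventures.PercRepro2.CrossClusterFunctional
import Summits.Ventures.PercRepro2.RootLeafUMixHb

/-!
# (G4-u): THE MIXED-COVARIANCE BOUND WITH `ρ = hb` — part 2: `0 ≤ hb·ℋ′ + X_b` (`hb_HoK_add_Xb_nonneg`)
and its consequences for `T2oK` (blind cell PercRepro2, p4 g14; S3 item (aa); no definitions)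

Under `P' = P(· | K avoids {u, c})` (`K = C(a₂)`, `L = C(u)`), the `ρ`-form of (MIX-K) reads
`Cov'(1_{c∈L}·(1_{b∈K} − ρ) − 1_{b∈L}, 1_{o∈K}) ≥ 0`; cleared by `P₀²` it is `0 ≤ ρ·ℋ′ + X_b`.  The ρ = 1 case
is the BHK step of RootLeafUMixKA.  THEOREM: it holds for `ρ = hb = P(a₂ ↔ b)`, the UNCONDITIONAL connection
probability of `b` to `a₂` (engine D350 add. 2: 0 violations on 992,702,520 cells; the conditional constants
`P(bK | PD)`, `P(bK | PD, o∉K)` are FALSE there).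

Proof (the exploration of `L = C(u)`, RootLeafUMixHb part 1): with `g(L) = P(b ∈ C(a₂) in G ∖ L)` and the
antitone `φ(L) = hb·1_{c∉L} + g(L)·1_{c∈L}`,
`P₀²·(hb·ℋ′ + X_b) = [P(T′,bK,oK)·P₀ − J·P₀] + [J·P₀ − J₀·P_o + hb·ℋ′] + [the b ∈ L slack]`, where
`J₀ = P(T′, bK)` and `J ≤ P(T′, bK, oK)` (`J0_eq`, `J_le`: exploration of `L` + Harris in `G ∖ L`), the middle
bracket is `P₀²·Cov'(φ(L), 1_{o∈K}) ≥ 0` by BHK06 Thm 1.4 in functional form (`bhk_cross_functional_avoid`),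
and the slack is `bL_mul_P0_le`.  Consequences: `lowK_hb_le_P0_mul_T2oK` (the `hb`-bound, sharper than the
ρ = 1 bound by `2β(1 − hb)ℋ′`) and `T2oK_nonneg_of_classK_hb`: `0 ≤ T2oK` on `(2β·hb − A)·ℋ′ ≤ ℰ·(e0P₀ − d0P_o)`.
-/

namespace Summit.Ventures.PercRepro2

open UnionCluster CovForm

namespace RootLeafU

namespace MixK

variable {V : Type*} {E : Type*} [Fintype E] [DecidableEq E] [Fintype V] [DecidableEq V]
  {R : Type*} [Field R] [LinearOrder R] [IsStrictOrderedRing R]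

section Main

variable (p : E → R) (ends : E → Sym2 V) (o a₂ c b u : V)

omit [Fintype V] [DecidableEq V] [LinearOrder R] [IsStrictOrderedRing R] in
/-- Linearity of `expect` for a pointwise sum. -/
lemma expect_add_fun (f g : Config E → R) :
    expect p (fun ω => f ω + g ω) = expect p f + expect p g :=
  expect_add p f g

omit [LinearOrder R] [IsStrictOrderedRing R] in
/-- **The splitting of `φ(L)·1_R`** (pointwise): `φ(C_u)·1_{a₂↮{u,c}} = 1_{c∈L}·g(L)·1_{u↮a₂} + hb·1_{PD}`. -/
lemma phi_mul_R_eq (ω : Config E) :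
    (({W : Set V | c ∈ W}).indicator (delClusterProb p ends a₂ {W : Set V | b ∈ W}) (cluster ends ω u) +
        ({W : Set V | c ∉ W}).indicator (fun _ => prob p (connEvent ends a₂ b)) (cluster ends ω u)) *
      (avoidAll ends a₂ {u, c}).indicator 1 ω =
    ({W : Set V | c ∈ W}).indicator (1 : Set V → R) (cluster ends ω u) *
        delClusterProb p ends a₂ {W : Set V | b ∈ W} (cluster ends ω u) *
        (avoidAll ends u {a₂}).indicator 1 ω +
      prob p (connEvent ends a₂ b) * (PDEvent ends u a₂ c).indicator 1 ω := by
  have hPD : PDEvent ends u a₂ c = avoidAll ends a₂ {u, c} ∩ (connEvent ends u c)ᶜ :=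
    (N_inter_uc_compl_eq ends a₂ c u).symm
  by_cases hc : Conn ends ω u c
  · have h1 : cluster ends ω u ∈ {W : Set V | c ∈ W} := hc
    have h2 : cluster ends ω u ∉ {W : Set V | c ∉ W} := fun h => h hc
    have h3 : ω ∉ PDEvent ends u a₂ c := by
      rw [hPD]
      exact fun h => h.2 hc
    rw [Set.indicator_of_mem h1, Set.indicator_of_notMem h2, Set.indicator_of_mem h1,
      Set.indicator_of_notMem h3]
    by_cases hR : ω ∈ avoidAll ends a₂ {u, c}
    · rw [Set.indicator_of_mem hR, Set.indicator_of_mem ((mem_R_iff_of_conn ends a₂ c u hc).1 hR)]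
      simp
    · rw [Set.indicator_of_notMem hR,
        Set.indicator_of_notMem (fun h => hR ((mem_R_iff_of_conn ends a₂ c u hc).2 h))]
      simp
  · have h1 : cluster ends ω u ∉ {W : Set V | c ∈ W} := hc
    have h2 : cluster ends ω u ∈ {W : Set V | c ∉ W} := hc
    rw [Set.indicator_of_notMem h1, Set.indicator_of_mem h2, Set.indicator_of_notMem h1]
    by_cases hR : ω ∈ avoidAll ends a₂ {u, c}
    · have h3 : ω ∈ PDEvent ends u a₂ c := by
        rw [hPD]
        exact ⟨hR, hc⟩
      rw [Set.indicator_of_mem hR, Set.indicator_of_mem h3]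
      simp
    · have h3 : ω ∉ PDEvent ends u a₂ c := by
        rw [hPD]
        exact fun h => hR h.1
      rw [Set.indicator_of_notMem hR, Set.indicator_of_notMem h3]
      simp

omit [LinearOrder R] [IsStrictOrderedRing R] in
/-- **The splitting of `1_{o∈K}·φ(L)·1_R`** (pointwise). -/
lemma oK_phi_mul_R_eq (ω : Config E) :
    ({W : Set V | o ∈ W}).indicator (1 : Set V → R) (cluster ends ω a₂) *
      (({W : Set V | c ∈ W}).indicator (delClusterProb p ends a₂ {W : Set V | b ∈ W}) (cluster ends ω u) +
        ({W : Set V | c ∉ W}).indicator (fun _ => prob p (connEvent ends a₂ b)) (cluster ends ω u)) *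
      (avoidAll ends a₂ {u, c}).indicator 1 ω =
    ({W : Set V | c ∈ W}).indicator (1 : Set V → R) (cluster ends ω u) *
        delClusterProb p ends a₂ {W : Set V | b ∈ W} (cluster ends ω u) *
        (connEvent ends a₂ o).indicator 1 ω * (avoidAll ends u {a₂}).indicator 1 ω +
      prob p (connEvent ends a₂ b) * (PDEvent ends u a₂ c ∩ connEvent ends a₂ o).indicator 1 ω := by
  have h := phi_mul_R_eq p ends a₂ c b u ω
  rw [indicator_mem_cluster_eq ends a₂ o ω]
  have e : (PDEvent ends u a₂ c ∩ connEvent ends a₂ o).indicator (1 : Config E → R) ω =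
      (PDEvent ends u a₂ c).indicator 1 ω * (connEvent ends a₂ o).indicator 1 ω := by
    by_cases h1 : ω ∈ PDEvent ends u a₂ c <;> by_cases h2 : ω ∈ connEvent ends a₂ o <;>
      simp [Set.indicator, h1, h2]
  rw [e]
  calc (connEvent ends a₂ o).indicator (1 : Config E → R) ω *
        (({W : Set V | c ∈ W}).indicator (delClusterProb p ends a₂ {W : Set V | b ∈ W}) (cluster ends ω u) +
          ({W : Set V | c ∉ W}).indicator (fun _ => prob p (connEvent ends a₂ b)) (cluster ends ω u)) *
        (avoidAll ends a₂ {u, c}).indicator 1 ω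
      = (connEvent ends a₂ o).indicator (1 : Config E → R) ω *
        ((({W : Set V | c ∈ W}).indicator (delClusterProb p ends a₂ {W : Set V | b ∈ W}) (cluster ends ω u) +
          ({W : Set V | c ∉ W}).indicator (fun _ => prob p (connEvent ends a₂ b)) (cluster ends ω u)) *
        (avoidAll ends a₂ {u, c}).indicator 1 ω) := by ring
    _ = _ := by rw [h]; ring

/-- **THE MIXED-COVARIANCE BOUND WITH `ρ = hb`**: `0 ≤ hb·ℋ′ + X_b` with `hb = P(a₂ ↔ b)`, i.e. under
`P(· | K avoids {u, c})`, `Cov'(1_{c∈L}·(1_{b∈K} − hb) − 1_{b∈L}, 1_{o∈K}) ≥ 0`.  Proof: the exploration of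
`L = C(u)` (`J0_eq`, `J_le` — Harris in `G ∖ L`), BHK06 Thm 1.4 in functional form for the antitone
`φ(L) = hb·1_{c∉L} + g(L)·1_{c∈L}` against `1_{o∈K}` (`bhk_cross_functional_avoid`), and the `b ∈ L`
slack `bL_mul_P0_le`. -/
theorem hb_HoK_add_Xb_nonneg (hp : IsProbVec p) :
    0 ≤ prob p (connEvent ends a₂ b) *
          (prob p (TEvent ends a₂ u c) * prob p (PDEvent ends u a₂ c ∩ connEvent ends a₂ o) -
            prob p (PDEvent ends u a₂ c) * prob p (TEvent ends a₂ u c ∩ connEvent ends a₂ o)) +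
        (prob p (TEvent ends a₂ u c ∩ (connEvent ends a₂ o ∩ connEvent ends a₂ b)) *
            (prob p (PDEvent ends u a₂ c) + prob p (TEvent ends a₂ u c)) -
          prob p (TEvent ends a₂ u c ∩ connEvent ends a₂ b) *
            (prob p (PDEvent ends u a₂ c ∩ connEvent ends a₂ o) +
              prob p (TEvent ends a₂ u c ∩ connEvent ends a₂ o)) -
          (prob p (PDEvent ends u a₂ c ∩ (connEvent ends a₂ o ∩ connEvent ends u b)) +
              prob p (TEvent ends a₂ u c ∩ (connEvent ends a₂ o ∩ connEvent ends u b))) *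
            (prob p (PDEvent ends u a₂ c) + prob p (TEvent ends a₂ u c)) +
          (prob p (PDEvent ends u a₂ c ∩ connEvent ends u b) +
              prob p (TEvent ends a₂ u c ∩ connEvent ends u b)) *
            (prob p (PDEvent ends u a₂ c ∩ connEvent ends a₂ o) +
              prob p (TEvent ends a₂ u c ∩ connEvent ends a₂ o))) := by
  classical
  have hφanti := phi_antitone p ends a₂ c b hp
  have hφ0 := phi_nonneg p ends a₂ c b hp
  have hF₁ : Monotone (({W : Set V | o ∈ W}).indicator (1 : Set V → R)) :=
    monotone_indicator_one_of_isUpperSet (fun _ _ h ho => h ho)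
  have hF₁0 : ∀ S, 0 ≤ ({W : Set V | o ∈ W}).indicator (1 : Set V → R) S :=
    fun S => Set.indicator_apply_nonneg fun _ => zero_le_one
  have hu : u ∈ ({u, c} : Finset V) := by simp
  have key := bhk_cross_functional_avoid p hp ends a₂ u hu hF₁ hF₁0 hφanti hφ0
  -- (e1) `E[1_{o∈K} 1_R] = P_o`
  have e1 : expect p (fun ω => ({W : Set V | o ∈ W}).indicator (1 : Set V → R) (cluster ends ω a₂) *
      (avoidAll ends a₂ {u, c}).indicator 1 ω) =
      prob p (PDEvent ends u a₂ c ∩ connEvent ends a₂ o) +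
        prob p (TEvent ends a₂ u c ∩ connEvent ends a₂ o) := by
    rw [← prob_clusterInEvent_inter_eq_expect, ExploreA3.clusterInEvent_mem_eq, Set.inter_comm,
      prob_N_inter p ends a₂ c u (connEvent ends a₂ o)]
  -- (e2) `P(R) = P₀`
  have e2 : prob p (avoidAll ends a₂ {u, c}) =
      prob p (PDEvent ends u a₂ c) + prob p (TEvent ends a₂ u c) := by
    have h := prob_N_inter p ends a₂ c u Set.univ
    simpa only [Set.inter_univ] using h
  -- (e3) `E[φ(L) 1_R] = P(T′, bK) + hb·D`
  have e3 : expect p (fun ω =>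
      (({W : Set V | c ∈ W}).indicator (delClusterProb p ends a₂ {W : Set V | b ∈ W}) (cluster ends ω u) +
        ({W : Set V | c ∉ W}).indicator (fun _ => prob p (connEvent ends a₂ b)) (cluster ends ω u)) *
      (avoidAll ends a₂ {u, c}).indicator 1 ω) =
      prob p (TEvent ends a₂ u c ∩ connEvent ends a₂ b) +
        prob p (connEvent ends a₂ b) * prob p (PDEvent ends u a₂ c) := by
    have e : (fun ω =>
        (({W : Set V | c ∈ W}).indicator (delClusterProb p ends a₂ {W : Set V | b ∈ W}) (cluster ends ω u) +
          ({W : Set V | c ∉ W}).indicator (fun _ => prob p (connEvent ends a₂ b)) (cluster ends ω u)) *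
        (avoidAll ends a₂ {u, c}).indicator 1 ω) =
        fun ω => ({W : Set V | c ∈ W}).indicator (1 : Set V → R) (cluster ends ω u) *
          delClusterProb p ends a₂ {W : Set V | b ∈ W} (cluster ends ω u) *
          (avoidAll ends u {a₂}).indicator 1 ω +
        prob p (connEvent ends a₂ b) * (PDEvent ends u a₂ c).indicator 1 ω :=
      funext fun ω => phi_mul_R_eq p ends a₂ c b u ω
    rw [e, expect_add_fun p (fun ω => ({W : Set V | c ∈ W}).indicator (1 : Set V → R) (cluster ends ω u) *
          delClusterProb p ends a₂ {W : Set V | b ∈ W} (cluster ends ω u) *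
          (avoidAll ends u {a₂}).indicator 1 ω)
        (fun ω => prob p (connEvent ends a₂ b) * (PDEvent ends u a₂ c).indicator 1 ω),
      expect_const_mul, ← prob_eq_expect_indicator, J0_eq]
  -- (e4) `E[1_{o∈K} φ(L) 1_R] = J + hb·P(PD, oK)`
  have e4 : expect p (fun ω => ({W : Set V | o ∈ W}).indicator (1 : Set V → R) (cluster ends ω a₂) *
      (({W : Set V | c ∈ W}).indicator (delClusterProb p ends a₂ {W : Set V | b ∈ W}) (cluster ends ω u) +
        ({W : Set V | c ∉ W}).indicator (fun _ => prob p (connEvent ends a₂ b)) (cluster ends ω u)) *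
      (avoidAll ends a₂ {u, c}).indicator 1 ω) =
      expect p (fun ω => ({W : Set V | c ∈ W}).indicator (1 : Set V → R) (cluster ends ω u) *
        delClusterProb p ends a₂ {W : Set V | b ∈ W} (cluster ends ω u) *
        (connEvent ends a₂ o).indicator 1 ω * (avoidAll ends u {a₂}).indicator 1 ω) +
        prob p (connEvent ends a₂ b) * prob p (PDEvent ends u a₂ c ∩ connEvent ends a₂ o) := by
    have e : (fun ω => ({W : Set V | o ∈ W}).indicator (1 : Set V → R) (cluster ends ω a₂) *
        (({W : Set V | c ∈ W}).indicator (delClusterProb p ends a₂ {W : Set V | b ∈ W}) (cluster ends ω u) +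
          ({W : Set V | c ∉ W}).indicator (fun _ => prob p (connEvent ends a₂ b)) (cluster ends ω u)) *
        (avoidAll ends a₂ {u, c}).indicator 1 ω) =
        fun ω => ({W : Set V | c ∈ W}).indicator (1 : Set V → R) (cluster ends ω u) *
          delClusterProb p ends a₂ {W : Set V | b ∈ W} (cluster ends ω u) *
          (connEvent ends a₂ o).indicator 1 ω * (avoidAll ends u {a₂}).indicator 1 ω +
        prob p (connEvent ends a₂ b) * (PDEvent ends u a₂ c ∩ connEvent ends a₂ o).indicator 1 ω :=
      funext fun ω => oK_phi_mul_R_eq p ends o a₂ c b u ω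
    rw [e, expect_add_fun p (fun ω => ({W : Set V | c ∈ W}).indicator (1 : Set V → R) (cluster ends ω u) *
          delClusterProb p ends a₂ {W : Set V | b ∈ W} (cluster ends ω u) *
          (connEvent ends a₂ o).indicator 1 ω * (avoidAll ends u {a₂}).indicator 1 ω)
        (fun ω => prob p (connEvent ends a₂ b) * (PDEvent ends u a₂ c ∩ connEvent ends a₂ o).indicator 1 ω),
      expect_const_mul, ← prob_eq_expect_indicator]
  rw [e1, e2, e3, e4] at key
  have hJ := J_le p ends o a₂ c b u hp
  have hbL := bL_mul_P0_le p ends o a₂ c b u hp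
  have hP0 : 0 ≤ prob p (PDEvent ends u a₂ c) + prob p (TEvent ends a₂ u c) :=
    add_nonneg (prob_nonneg hp _) (prob_nonneg hp _)
  have key2 := mul_le_mul_of_nonneg_right (add_le_add_right hJ
    (prob p (connEvent ends a₂ b) * prob p (PDEvent ends u a₂ c ∩ connEvent ends a₂ o))) hP0
  nlinarith [key, key2, hbL]

end Main

section Consequences

variable (p : E → R) (ends : E → Sym2 V) (o a₂ c b u : V)

/-- **The `hb`-lower bound of the `o ∈ K` half**: `lowK_hb = (A − 2β·hb)·ℋ′ + ℰ·(e0P₀ − d0P_o) ≤ P₀·T2oK`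
(the master identity `P0_mul_T2oK_eq` with `hb·ℋ′ + X_b ≥ 0`); sharper than the ρ = 1 bound `lowK` of
RootLeafUMixSum by `2β·(1 − hb)·ℋ′ ≥ 0`. -/
theorem lowK_hb_le_P0_mul_T2oK (hp : IsProbVec p) :
    (((prob p (PDEvent ends u a₂ c) * prob p (connEvent ends a₂ b) +
            prob p (avoidAll ends a₂ {c}) * gap p ends u a₂ b) +
          (prob p Set.univ * EQb3 p ends u a₂ c b + prob p Set.univ * PDb p ends u a₂ c b +
            prob p (connEvent ends a₂ b) * EQ3 p ends u a₂ c +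
            prob p (connEvent ends a₂ b) * prob p (avoidAll ends a₂ {u}) -
            (prob p Set.univ - prob p (avoidAll ends a₂ {c})) * gap p ends u a₂ b)) -
        2 * (prob p Set.univ * prob p (PDEvent ends u a₂ c) +
          prob p (avoidAll ends a₂ {c}) * prob p (avoidAll ends a₂ {u})) *
          prob p (connEvent ends a₂ b)) *
        (prob p (TEvent ends a₂ u c) * prob p (PDEvent ends u a₂ c ∩ connEvent ends a₂ o) -
          prob p (PDEvent ends u a₂ c) * prob p (TEvent ends a₂ u c ∩ connEvent ends a₂ o)) +
      Ee p ends a₂ c b u *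
        (prob p (avoidAll ends a₂ {c} ∩ connEvent ends a₂ o) *
            (prob p (PDEvent ends u a₂ c) + prob p (TEvent ends a₂ u c)) -
          prob p (avoidAll ends a₂ {c}) *
            (prob p (PDEvent ends u a₂ c ∩ connEvent ends a₂ o) +
              prob p (TEvent ends a₂ u c ∩ connEvent ends a₂ o))) ≤
    (prob p (PDEvent ends u a₂ c) + prob p (TEvent ends a₂ u c)) * T2oK p ends o a₂ c b u := by
  have hid := P0_mul_T2oK_eq p ends o a₂ c b u
  have hhb := hb_HoK_add_Xb_nonneg p ends o a₂ c b u hp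
  have hβ : 0 ≤ prob p Set.univ * prob p (PDEvent ends u a₂ c) +
      prob p (avoidAll ends a₂ {c}) * prob p (avoidAll ends a₂ {u}) :=
    add_nonneg (mul_nonneg (prob_nonneg hp _) (prob_nonneg hp _))
      (mul_nonneg (prob_nonneg hp _) (prob_nonneg hp _))
  rw [hid]
  nlinarith [mul_nonneg hβ hhb]

/-- **The `o ∈ K` half on the class `(2β·hb − A)·ℋ′ ≤ ℰ·(e0P₀ − d0P_o)`**: `0 ≤ T2oK` (contains the class
`(2β − A)·ℋ′ ≤ ℰ·(e0P₀ − d0P_o)` of RootLeafUMixClass, since `hb ≤ 1` and `ℋ′ ≥ 0`). -/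
theorem T2oK_nonneg_of_classK_hb (hp : IsProbVec p)
    (hcls : (2 * (prob p Set.univ * prob p (PDEvent ends u a₂ c) +
          prob p (avoidAll ends a₂ {c}) * prob p (avoidAll ends a₂ {u})) *
          prob p (connEvent ends a₂ b) -
        ((prob p (PDEvent ends u a₂ c) * prob p (connEvent ends a₂ b) +
            prob p (avoidAll ends a₂ {c}) * gap p ends u a₂ b) +
          (prob p Set.univ * EQb3 p ends u a₂ c b + prob p Set.univ * PDb p ends u a₂ c b +
            prob p (connEvent ends a₂ b) * EQ3 p ends u a₂ c +
            prob p (connEvent ends a₂ b) * prob p (avoidAll ends a₂ {u}) -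
            (prob p Set.univ - prob p (avoidAll ends a₂ {c})) * gap p ends u a₂ b))) *
        (prob p (TEvent ends a₂ u c) * prob p (PDEvent ends u a₂ c ∩ connEvent ends a₂ o) -
          prob p (PDEvent ends u a₂ c) * prob p (TEvent ends a₂ u c ∩ connEvent ends a₂ o)) ≤
      Ee p ends a₂ c b u *
        (prob p (avoidAll ends a₂ {c} ∩ connEvent ends a₂ o) *
            (prob p (PDEvent ends u a₂ c) + prob p (TEvent ends a₂ u c)) -
          prob p (avoidAll ends a₂ {c}) *
            (prob p (PDEvent ends u a₂ c ∩ connEvent ends a₂ o) +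
              prob p (TEvent ends a₂ u c ∩ connEvent ends a₂ o)))) :
    0 ≤ T2oK p ends o a₂ c b u := by
  have hlow := lowK_hb_le_P0_mul_T2oK p ends o a₂ c b u hp
  have hP0 : 0 ≤ prob p (PDEvent ends u a₂ c) + prob p (TEvent ends a₂ u c) :=
    add_nonneg (prob_nonneg hp _) (prob_nonneg hp _)
  rcases hP0.lt_or_eq with hpos | hzero
  · have h : 0 ≤ (prob p (PDEvent ends u a₂ c) + prob p (TEvent ends a₂ u c)) * T2oK p ends o a₂ c b u := by
      linarith [hlow, hcls]
    rcases lt_or_ge (T2oK p ends o a₂ c b u) 0 with hneg | hge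
    · have := mul_neg_of_pos_of_neg hpos hneg
      linarith
    · exact hge
  · have hz := hzero.symm
    have hE := Ee_nonneg p ends a₂ c b u hp
    have he0 := prob_nonneg hp (avoidAll ends a₂ {c} ∩ connEvent ends a₂ o)
    unfold T2oK
    have h1 := prob_PD_eq_zero_of_P0 p ends a₂ c u hp hz (connEvent ends a₂ o)
    have h2 := prob_PD_eq_zero_of_P0 p ends a₂ c u hp hz (connEvent ends a₂ o ∩ connEvent ends a₂ b)
    have h3 := prob_PD_eq_zero_of_P0 p ends a₂ c u hp hz (connEvent ends a₂ o ∩ connEvent ends u b)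
    rw [h1.1, h1.2, h2.2, h3.1, h3.2]
    have := mul_nonneg hE he0
    linarith

end Consequences

end MixK

end RootLeafU

end Summit.Ventures.PercRepro2
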